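import Literature.FieldTheory.Regular.FiniteAlgebraicClosureAnyChar
import Mathlib.FieldTheory.SeparablyGenerated
import Mathlib.FieldTheory.Galois.Basic
import Mathlib.FieldTheory.AlgebraicClosure
import Mathlib.RingTheory.AlgebraicIndependent.AlgebraicClosure
import Mathlib.RingTheory.AlgebraicIndependent.TranscendenceBasis
import HarnessLib

/-!
# `WildQuotients.SummitReduction` (stmt-ResolutionOfSingularities-16324), line `FramePerfect`, stub 1a:
# the invariant subfield `L = R(Y)` of de Jong 1997, Lemma 5.2

Route `ResolutionOfSingularities/WildQuotients`, crux `SummitReduction`; helper file of stub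
`stub_pair_equivariantFibration`. De Jong 1997, Lemma 5.2 (proof, p. 613): "The conditions on `f`
imply that the field extension `R(S) ⊂ R(X)` is separable. Choose `x₁, …, x_{d-1} ∈ R(X)^G` which
are algebraically independent over `R(S)` and such that `R(X)` is separable over
`R(S)(x₁, …, x_{d-1})`. […] the field extension `R(Y) ⊂ R(X')` is separable and `R(Y)` is
algebraically closed in `R(X')`." Over `S = Spec k` with `k` perfect this file produces, for a
finitely generated extension `K/k` of transcendence degree `d + 1` with a finite group `G` acting
by `k`-automorphisms, the field-theoretic datum of the fibration:

* `IntermediateField.fg_of_isAlgebraic_of_essFiniteType'` — an intermediate field over which `K`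
  is algebraic is finitely generated over `k` (so `K^G` is, and Mathlib's separating transcendence
  bases over perfect fields apply to `K^G`);
* `exists_invariant_isAlgClosedIn_subfield` — MAIN: `G`-invariant `x₁, …, x_d ∈ K` algebraically
  independent over `k`, and the algebraic closure `L` of `k(x₁, …, x_d)` in `K`: a `G`-stable
  subfield, finite over `k(x)`, relatively algebraically closed in `K`, of transcendence degree `d`,
  over which `K` has a separating transcendental element `x₀` (`K/L(x₀)` separable algebraic,
  `trdeg_L K = 1`).
-/

set_option linter.dupNamespace false

open scoped IntermediateField
open Cardinal

namespace Summit.ResolutionOfSingularities.ResolutionOfSingularities.Theorems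

/-! ## Intermediate fields under an algebraic top are finitely generated -/

/-- **An intermediate field `M` of a finitely generated extension `K/k` with `K/M` algebraic is
finitely generated over `k`.** Write `K = k(t₁, …, tₙ)`; the coefficients of the minimal
polynomials of the `tᵢ` over `M` generate a subfield `F' ⊆ M` over which `K` is finite, so `M/F'`
is finite and `M = F'(basis)` is finitely generated. (Applied to `M = K^G`.) [folklore] -/
theorem IntermediateField.fg_of_isAlgebraic_of_essFiniteType' {k K : Type*} [Field k] [Field K]
    [Algebra k K] [Algebra.EssFiniteType k K] (M : IntermediateField k K)
    [Algebra.IsAlgebraic M K] : M.FG := by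
  classical
  obtain ⟨T, hT⟩ := IntermediateField.fg_top k K
  -- coefficients of the minimal polynomials over `M`, as elements of `K`
  let C : Finset K := T.biUnion fun t => ((minpoly M t).map (algebraMap M K)).coeffs
  let F' : IntermediateField k K := IntermediateField.adjoin k (C : Set K)
  have hCM : (C : Set K) ⊆ M := by
    intro c hc
    simp only [C, Finset.coe_biUnion, Finset.mem_coe, Set.mem_iUnion, exists_prop] at hc
    obtain ⟨t, -, hc⟩ := hc
    obtain ⟨n, -, hn⟩ := Polynomial.mem_coeffs_iff.mp hc
    rw [hn, Polynomial.coeff_map]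
    exact ((minpoly M t).coeff n).2
  have hF'M : F' ≤ M := IntermediateField.adjoin_le_iff.mpr hCM
  -- every generator is integral over `F'`
  have hint : ∀ t ∈ (T : Set K), IsIntegral F' t := by
    intro t ht
    have hl : (minpoly M t).map (algebraMap M K) ∈ Polynomial.lifts (algebraMap F' K) := by
      rw [Polynomial.lifts_iff_coeff_lifts]
      intro n
      by_cases hn : ((minpoly M t).map (algebraMap M K)).coeff n = 0
      · rw [hn]; exact ⟨0, map_zero _⟩
      · have hc : ((minpoly M t).map (algebraMap M K)).coeff n ∈ C := by
          simp only [C, Finset.mem_biUnion]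
          exact ⟨t, ht, Polynomial.coeff_mem_coeffs hn⟩
        exact ⟨⟨_, IntermediateField.subset_adjoin k _ hc⟩, rfl⟩
    have hmonic : ((minpoly M t).map (algebraMap M K)).Monic :=
      (minpoly.monic (Algebra.IsIntegral.isIntegral t)).map _
    obtain ⟨q, hq, -, hqm⟩ := Polynomial.lifts_and_natDegree_eq_and_monic hl hmonic
    refine ⟨q, hqm, ?_⟩
    have h0 : Polynomial.aeval t (minpoly M t) = 0 := minpoly.aeval M t
    rw [Polynomial.aeval_def, ← Polynomial.eval_map] at h0
    rw [Polynomial.eval₂_eq_eval_map, hq]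
    exact h0
  -- so `K/F'` is finite
  haveI : FiniteDimensional F' K := by
    have htop : IntermediateField.adjoin F' (T : Set K) = ⊤ := by
      apply IntermediateField.restrictScalars_injective k
      rw [IntermediateField.restrictScalars_top, eq_top_iff, ← hT]
      exact IntermediateField.adjoin_le_iff.mpr
        (IntermediateField.subset_adjoin F' (T : Set K))
    haveI : FiniteDimensional F' (IntermediateField.adjoin F' (T : Set K)) :=
      IntermediateField.finiteDimensional_adjoin hint
    rw [htop] at this
    exact IntermediateField.topEquiv.toLinearEquiv.finiteDimensional
  -- hence `M/F'` is finitely generated, and so is `M/k`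
  obtain ⟨T', hT'⟩ := (IntermediateField.extendScalars hF'M).fg_of_noetherian
  refine ⟨C ∪ T', ?_⟩
  rw [Finset.coe_union, ← IntermediateField.adjoin_adjoin_left, hT',
    IntermediateField.extendScalars_restrictScalars]

/-! ## The invariant subfield `L` -/

/-- **The subfield `L = R(Y)` of de Jong 1997, Lemma 5.2, over a perfect ground field.** Let `k`
be perfect, `K/k` finitely generated of transcendence degree `d + 1`, and let the finite group `G`
act on `K` by `k`-automorphisms `γ`. Then there are `G`-invariant `x₁, …, x_d ∈ K` (a finset `S`),
algebraically independent over `k`, an element `x₀ ∈ K`, and — with `L` the algebraic closure of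
`k(x₁, …, x_d)` in `K` — : `L/k(x)` is finite; `L` is `G`-stable; `L` is relatively algebraically
closed in `K`; `x₀` is transcendental over `L` and `K/L(x₀)` is separable algebraic;
`trdeg_k L = d` and `trdeg_L K = 1`. Proof: `K/K^G` is Galois and `K^G/k` is finitely generated
(`IntermediateField.fg_of_isAlgebraic_of_essFiniteType'`), so `K^G` has a separating
transcendence basis `x₀, …, x_d` over the perfect `k` (Mathlib, Stacks 030W); `K/k(x₀, …, x_d)` is
then separable, and everything else is transcendence-degree bookkeeping.
[cite: DeJong1997, Lemma 5.2 (proof), p. 613] -/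
theorem exists_invariant_isAlgClosedIn_subfield (k K : Type*) [Field k] [PerfectField k]
    [Field K] [Algebra k K] [Algebra.EssFiniteType k K] {G : Type*} [Group G] [Finite G]
    (γ : G →* (K ≃ₐ[k] K)) (d : ℕ) (htr : Algebra.trdeg k K = (d + 1 : ℕ)) :
    ∃ (S : Finset K) (x₀ : K),
      S.card = d ∧ AlgebraicIndependent k ((↑) : S → K) ∧ (∀ g : G, ∀ s ∈ S, γ g s = s) ∧
      FiniteDimensional (IntermediateField.adjoin k (S : Set K))
        (algebraicClosure (IntermediateField.adjoin k (S : Set K)) K) ∧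
      (∀ (g : G) (a : K), a ∈ algebraicClosure (IntermediateField.adjoin k (S : Set K)) K →
        γ g a ∈ algebraicClosure (IntermediateField.adjoin k (S : Set K)) K) ∧
      (∀ z : K, IsAlgebraic (algebraicClosure (IntermediateField.adjoin k (S : Set K)) K) z →
        z ∈ Set.range (algebraMap (algebraicClosure (IntermediateField.adjoin k (S : Set K)) K) K)) ∧
      Transcendental (algebraicClosure (IntermediateField.adjoin k (S : Set K)) K) x₀ ∧
      Algebra.IsSeparable (algebraicClosure (IntermediateField.adjoin k (S : Set K)) K)⟮x₀⟯ K ∧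
      Algebra.trdeg k (algebraicClosure (IntermediateField.adjoin k (S : Set K)) K) = d ∧
      Algebra.trdeg (algebraicClosure (IntermediateField.adjoin k (S : Set K)) K) K = 1 := by
  classical
  -- the fixed field `K^G`
  let H : Subgroup (K ≃ₐ[k] K) := γ.range
  haveI : Finite H := (Set.finite_range γ).to_subtype
  let KG : IntermediateField k K := IntermediateField.fixedField H
  have hmemKG : ∀ a : K, a ∈ KG ↔ ∀ g : G, γ g a = a := by
    intro a
    rw [IntermediateField.mem_fixedField_iff]
    constructor
    · exact fun h g => h (γ g) ⟨g, rfl⟩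
    · rintro h _ ⟨g, rfl⟩
      exact h g
  -- `K/K^G` is Galois, in particular separable (algebraic)
  haveI hsepKG : Algebra.IsSeparable KG K := by
    haveI : IsGalois (FixedPoints.subfield H K) K := IsGalois.of_fixed_field K H
    let e₁ : FixedPoints.subfield H K ≃+* KG :=
      { toFun := fun a => ⟨a.1, a.2⟩
        invFun := fun a => ⟨a.1, a.2⟩
        left_inv := fun _ => rfl
        right_inv := fun _ => rfl
        map_mul' := fun _ _ => rfl
        map_add' := fun _ _ => rfl }
    exact Algebra.IsSeparable.of_equiv_equiv e₁ (RingEquiv.refl K) (by ext; rfl)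
  haveI : Algebra.IsAlgebraic KG K := inferInstance
  -- `K^G/k` is finitely generated; separating transcendence basis over the perfect `k`
  haveI : Algebra.EssFiniteType k KG :=
    IntermediateField.essFiniteType_iff.mpr
      (IntermediateField.fg_of_isAlgebraic_of_essFiniteType' KG)
  obtain ⟨s, hs, hsep⟩ := exists_isTranscendenceBasis_and_isSeparable_of_perfectField k KG
  -- `#s = d + 1`
  have hcard : s.card = d + 1 := by
    have h1 : #s = Algebra.trdeg k KG := hs.cardinalMk_eq_trdeg
    have h2 : Algebra.trdeg k KG + Algebra.trdeg KG K = Algebra.trdeg k K :=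
      trdeg_add_eq k (S := KG) (A := K)
    rw [trdeg_eq_zero (R := KG) (A := K), add_zero, htr] at h2
    rw [h2, Cardinal.mk_coe_finset] at h1
    exact_mod_cast h1
  -- choose `x₀ ∈ s`; `S := s ∖ {x₀}` and `T := s`, read in `K`
  obtain ⟨x₀', hx₀'⟩ : s.Nonempty := Finset.card_pos.mp (by omega)
  let x₀ : K := (x₀' : K)
  let S : Finset K := (s.erase x₀').image fun a : KG => (a : K)
  let T : Finset K := s.image fun a : KG => (a : K)
  have hST : S ⊆ T := Finset.image_subset_image (Finset.erase_subset _ _)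
  have hx₀T : x₀ ∈ T := Finset.mem_image_of_mem _ hx₀'
  have hx₀S : x₀ ∉ S := by
    intro h
    obtain ⟨a, ha, hax⟩ := Finset.mem_image.mp h
    have : a = x₀' := Subtype.ext hax
    exact (Finset.mem_erase.mp ha).1 this
  have hTeq : insert x₀ S = T := by
    apply Finset.Subset.antisymm (Finset.insert_subset hx₀T hST)
    intro t ht
    obtain ⟨a, ha, rfl⟩ := Finset.mem_image.mp ht
    by_cases hax : a = x₀'
    · subst hax; exact Finset.mem_insert_self _ _
    · exact Finset.mem_insert_of_mem (Finset.mem_image_of_mem _ (Finset.mem_erase.mpr ⟨hax, ha⟩))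
  have hScard : S.card = d := by
    rw [Finset.card_image_of_injective _ Subtype.val_injective, Finset.card_erase_of_mem hx₀',
      hcard, Nat.add_sub_cancel]
  -- algebraic independence in `K`
  have hindT : AlgebraicIndependent k ((↑) : ↥(T : Set K) → K) := by
    have h1 : AlgebraicIndependent k (KG.val ∘ ((↑) : s → KG)) :=
      hs.1.map' (f := KG.val) (RingHom.injective _)
    refine h1.to_subtype_range' ?_
    ext z
    simp only [Set.mem_range, Function.comp_apply, Finset.coe_image, Set.mem_image,
      Finset.mem_coe, T, Subtype.exists, exists_prop]
    constructor
    · rintro ⟨a, ha, hmem, rfl⟩; exact ⟨a, ha, hmem, rfl⟩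
    · rintro ⟨a, ha, hmem, rfl⟩; exact ⟨a, ha, hmem, rfl⟩
  have hindS : AlgebraicIndependent k ((↑) : ↥(S : Set K) → K) :=
    hindT.mono (Finset.coe_subset.mpr hST)
  -- invariance
  have hTinv : ∀ g : G, ∀ t ∈ T, γ g t = t := by
    intro g t ht
    obtain ⟨a, -, rfl⟩ := Finset.mem_image.mp ht
    exact (hmemKG a).mp a.2 g
  have hSinv : ∀ g : G, ∀ t ∈ S, γ g t = t := fun g t ht => hTinv g t (hST ht)
  -- the fields `F = k(S) ⊆ L = F^{alg ∩ K}`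
  set F : IntermediateField k K := IntermediateField.adjoin k (S : Set K) with hFdef
  have hFKG : F ≤ KG := by
    rw [hFdef, IntermediateField.adjoin_le_iff]
    intro t ht
    exact (hmemKG t).mpr fun g => hSinv g t ht
  have hFfix : ∀ (g : G) (c : F), γ g (c : K) = c := fun g c => (hmemKG _).mp (hFKG c.2) g
  set L : IntermediateField F K := algebraicClosure F K with hLdef
  haveI : Algebra.EssFiniteType F K := Algebra.EssFiniteType.of_comp k F K
  haveI hLfin : FiniteDimensional F L :=
    Literature.FieldTheory.Regular.finiteDimensional_algebraicClosure
  haveI : IsScalarTower k L K := IsScalarTower.of_algebraMap_eq fun _ => rfl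
  -- `L` is `G`-stable
  have hLstab : ∀ (g : G) (a : K), a ∈ L → γ g a ∈ L := by
    intro g a ha
    let φ : K →ₐ[F] K :=
      { (γ g : K ≃ₐ[k] K).toRingEquiv.toRingHom with commutes' := fun c => hFfix g c }
    have ha' : IsAlgebraic F a := mem_algebraicClosure_iff.mp ha
    exact mem_algebraicClosure_iff.mpr (ha'.algHom φ)
  -- `L` is relatively algebraically closed in `K`
  have hrac : ∀ z : K, IsAlgebraic L z → z ∈ Set.range (algebraMap L K) := by
    intro z hz
    have h1 : z ∈ algebraicClosure L K := mem_algebraicClosure_iff.mpr hz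
    rw [hLdef, algebraicClosure.algebraicClosure_eq_bot] at h1
    exact IntermediateField.mem_bot.mp h1
  -- `x₀` is transcendental over `F`, hence over `L`
  have hTF : Transcendental F x₀ := by
    rw [hFdef, IntermediateField.transcendental_adjoin_iff]
    have h := hindT.transcendental_adjoin (s := ((↑) : ↥(T : Set K) → K) ⁻¹' (S : Set K))
      (i := ⟨x₀, by exact_mod_cast hx₀T⟩) (by simpa using hx₀S)
    have himg : ((↑) : ↥(T : Set K) → K) '' (((↑) : ↥(T : Set K) → K) ⁻¹' (S : Set K)) = S := by
      rw [Subtype.image_preimage_coe]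
      exact Set.inter_eq_right.mpr (Finset.coe_subset.mpr hST)
    rwa [himg] at h
  have hTL : Transcendental L x₀ := by
    intro halg
    apply hTF
    have hint : IsIntegral L x₀ := halg.isIntegral
    exact (isIntegral_trans x₀ hint).isAlgebraic
  -- `K / L(x₀)` is separable: `K / K^G` and `K^G / k(s)` are, and `k(s) ⊆ L(x₀)`
  have hsepL : Algebra.IsSeparable L⟮x₀⟯ K := by
    let A₀ : IntermediateField k KG := IntermediateField.adjoin k (s : Set KG)
    let A₁ : IntermediateField k K := IntermediateField.adjoin k (T : Set K)
    have hA : A₀.map KG.val = A₁ := by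
      rw [IntermediateField.adjoin_map]
      congr 1
      ext z
      simp [T]
    haveI : Algebra.IsSeparable A₀ K := Algebra.IsSeparable.trans A₀ KG K
    let e₁ : A₀ ≃+* A₁ :=
      ((IntermediateField.equivMap A₀ KG.val).trans (IntermediateField.equivOfEq hA)).toRingEquiv
    haveI hsepA₁ : Algebra.IsSeparable A₁ K :=
      Algebra.IsSeparable.of_equiv_equiv e₁ (RingEquiv.refl K) (by ext a; rfl)
    have hle : ∀ t ∈ (A₁ : Set K), t ∈ (L⟮x₀⟯ : Set K) := by
      have h : A₁ ≤ (L⟮x₀⟯).restrictScalars k := by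
        rw [IntermediateField.adjoin_le_iff, ← hTeq, Finset.coe_insert]
        rintro t (rfl | ht)
        · exact IntermediateField.mem_adjoin_simple_self L x₀
        · have htF : t ∈ F := IntermediateField.subset_adjoin k _ ht
          have htL : t ∈ L := by
            rw [hLdef, mem_algebraicClosure_iff]
            exact isAlgebraic_algebraMap (⟨t, htF⟩ : F)
          exact (IntermediateField.algebraMap_mem L⟮x₀⟯ (⟨t, htL⟩ : L))
      exact fun t ht => h ht
    letI : Algebra A₁ L⟮x₀⟯ :=
      ({ toFun := fun a => ⟨a.1, hle a.1 a.2⟩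
         map_one' := rfl
         map_mul' := fun _ _ => rfl
         map_zero' := rfl
         map_add' := fun _ _ => rfl } : A₁ →+* L⟮x₀⟯).toAlgebra
    haveI : IsScalarTower A₁ L⟮x₀⟯ K := IsScalarTower.of_algebraMap_eq fun _ => rfl
    exact Algebra.isSeparable_tower_top_of_isSeparable A₁ L⟮x₀⟯ K
  -- transcendence degrees
  have htr1 : Algebra.trdeg L K = 1 := by
    have hind0 : AlgebraicIndependent L (fun _ : PUnit.{_} => x₀) :=
      algebraicIndependent_unique_type_iff.mpr hTL
    have halgtop : Algebra.IsAlgebraic (Algebra.adjoin L (Set.range fun _ : PUnit => x₀)) K := by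
      rw [Set.range_const, ← IntermediateField.isAlgebraic_adjoin_iff_top]
      exact Algebra.IsSeparable.isAlgebraic _ _
    have hbasis : IsTranscendenceBasis L (fun _ : PUnit => x₀) :=
      hind0.isTranscendenceBasis_iff_isAlgebraic.mpr halgtop
    have h := hbasis.cardinalMk_eq_trdeg
    rw [Cardinal.mk_eq_one] at h
    exact h.symm
  have htrd : Algebra.trdeg k L = d := by
    have h := trdeg_add_eq k (S := L) (A := K)
    rw [htr1, htr, Nat.cast_add, Nat.cast_one] at h
    exact Cardinal.eq_of_add_eq_add_right h Cardinal.one_lt_aleph0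
  exact ⟨S, x₀, hScard, hindS, hSinv, hLfin, hLstab, hrac, hTL, hsepL, htrd, htr1⟩

end Summit.ResolutionOfSingularities.ResolutionOfSingularities.Theorems
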